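import Summits.HubbardSuperconductivity.HubbardSuperconductivity.Theorems.TwistGapTgCruxGlue
import Summits.HubbardSuperconductivity.HubbardSuperconductivity.Theorems.DeformationLadderLadderThesisRigidityReduction
import HarnessLib

/-!
# `LadderThesis` (stmt-HubbardSuperconductivity-1890) from the two TwistGap cruxes — split glue

The strategist's D1 glue for the corner class `{LadderThesis 1890, LowEnergyRigidity 1892,
TwistGap.TgThesis 1508}` (Cruxes/LadderThesis/STRATEGY-CENSUS.md, 2026-08-16): the route-X thesis
`DeformationLadder.LadderThesis` follows BY NAME from the two TwistGap cruxes
`TgPairMomentumRigidity` (stmt-1509: pair weight at nonzero infrared pair momenta costs energy) and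
`TgLowEnergyCondensation` (stmt-1510: every low-energy state carries infrared pair weight), by
composing the landed `TwistGap.lowEnergyRigidity_of_tgCruxes` (p-landed glue, file
`TwistGapTgCruxGlue`) with the landed reduction `ladderThesis_of_lowEnergyRigidity`
(`DeformationLadderLadderThesisRigidityReduction`, p88396). This is the glue a planner needs for
`ledger route edit … --split LadderThesis` into the two TwistGap children; it proves nothing new about
the Hubbard model (both hypotheses are open cruxes). No new definitions.
-/

set_option linter.dupNamespace false

namespace Summit.HubbardSuperconductivity.HubbardSuperconductivity.Theorems.DeformationLadder

open Summit.HubbardSuperconductivity.HubbardSuperconductivity.Theses.DeformationLadder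
open Summit.HubbardSuperconductivity.HubbardSuperconductivity.Theses.TwistGap

/-- **Split glue.** `TgPairMomentumRigidity → TgLowEnergyCondensation → LadderThesis`: the two
TwistGap cruxes (stmt-1509, stmt-1510) give `LowEnergyRigidity` (`TwistGap.lowEnergyRigidity_of_tgCruxes`,
with `(κ, a) = (min(Γ, γθ/4), θ/4)`), and `LowEnergyRigidity` gives the penalised-family thesis
`LadderThesis` (`ladderThesis_of_lowEnergyRigidity`, `s = κ/64`). Conditional on two open cruxes;
recorded as the deciding glue for a route split of `LadderThesis`. [folklore] -/
theorem ladderThesis_of_tgCruxes (hR : TgPairMomentumRigidity) (hC : TgLowEnergyCondensation) :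
    LadderThesis :=
  ladderThesis_of_lowEnergyRigidity (TwistGap.lowEnergyRigidity_of_tgCruxes hR hC)

end Summit.HubbardSuperconductivity.HubbardSuperconductivity.Theorems.DeformationLadder
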